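import Summits.NavierStokesRegularity.FluidComputer.BlockStatics
import Literature.Analysis.FluidPDE.TaoAveragedSlotAlgebra

/-!
# Fourier-block design, V: `H¹⁰` control of the shadowing tube, and self-similarity

HONEST FRAMING (cell `pub-fluidc`, verbatim): *low prior, high value-of-information experiment on
Tao's machine paradigm; NOT a claim that NS blows up.*

Two more design-level facts for the concrete Fourier-block design (`BlockReadout`–`BlockStatics`):

* `Dynamics.h10Control` — the liveness hypothesis `ShadowedCircuit.H10Control` of
  `CircuitArchitecture.lean` HOLDS for the assembled design as soon as the junk order is `s ≥ 10`,
  the infrared floor is `μ > 0`, and the circuit tube `{Φ σ p : p ∈ Ain, 0 ≤ σ ≤ τc}` is bounded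
  in the observable plane (a property of the finite-dimensional circuit alone). Mechanism: a state
  with running junk has a design state `recon n q` within weighted distance `2 jrun √E_n`; the
  weight dominates `(1+|ξ|²)^5` up to a constant `32 λ_n^{10} (λ_n/μ)^s`, and `|q|` is bounded by
  the readout (near the bounded tube) plus the junk (`h10Bound_of_read_le`: the `H¹⁰` bound from a
  readout bound and running junk, tube-free). So, for this design, LIVENESS of the pump cascade is a
  theorem of the mild `H¹⁰` theory given only the residue `Dynamics` and a bounded tube.
* `Dynamics.isSelfSimilar` — the design states are exactly self-similar
  (`recon n p = √(E_n/E_0) · Dil_{2ⁿ} (recon 0 p)`), the documentation predicate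
  `ShadowedCircuit.IsSelfSimilar`.

No statement about the Navier–Stokes PDE is made here.
-/

noncomputable section

open MeasureTheory Set Filter Topology Metric
open scoped ENNReal NNReal SchwartzMap

namespace Summit.NavierStokesRegularity.FluidComputer

open Literature.Analysis.FluidPDE Literature.Analysis.FluidPDE.Tao2016
open Literature.Analysis.FluidPDE.FluidComputer
open Literature.Analysis.FunctionSpaces (eFourierSobolevNorm)

namespace BlockDesign

/-! ### §1. The `H^{s'}` norm in the form of `BlockJunk`, and its homogeneity -/

/-- `‖u‖_{H^{s'}} = (∫ ((1+|ξ|²)^{s'/2} |û|)²)^{1/2}`. [folklore] -/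
theorem eFourierSobolevNorm_eq_half (s' : ℝ) (u : L2C) :
    eFourierSobolevNorm s' u =
      (∫⁻ ξ, (ENNReal.ofReal ((1 + ‖ξ‖ ^ 2) ^ (s' / 2)) * ‖fourierFn u ξ‖ₑ) ^ (2 : ℝ)) ^ (1 / 2 : ℝ) := by
  unfold eFourierSobolevNorm fourierFn
  congr 1
  refine lintegral_congr fun ξ => ?_
  rw [ENNReal.mul_rpow_of_nonneg _ _ (by norm_num : (0 : ℝ) ≤ 2), ENNReal.rpow_two, ENNReal.rpow_two,
    ← ENNReal.ofReal_pow (by positivity)]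
  congr 2
  rw [← Real.rpow_natCast ((1 + ‖ξ‖ ^ 2) ^ (s' / 2)) 2, ← Real.rpow_mul (by positivity),
    show s' / 2 * ((2 : ℕ) : ℝ) = s' by push_cast; ring]

/-- **Absolute homogeneity** of the `H^{s'}` norm, in the `≤` form used below (stated one-sided so as
not to restate a declaration that exists elsewhere in the tree). [folklore] -/
theorem eFourierSobolevNorm_smul_le (s' : ℝ) (c : ℂ) (u : L2C) :
    eFourierSobolevNorm s' (c • u) ≤ ‖c‖ₑ * eFourierSobolevNorm s' u := by
  apply le_of_eq
  rw [eFourierSobolevNorm_eq_half, eFourierSobolevNorm_eq_half,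
    ← lintegral_half_const_mul _ enorm_ne_top]
  congr 1
  refine lintegral_congr_ae ?_
  filter_upwards [fourierFn_smul c u] with ξ hξ
  rw [hξ, enorm_smul]
  ring_nf

/-- Weighted comparison: a pointwise bound `(1+|ξ|²)^{s'/2} ≤ C · w_{μ,κ,s}(ξ)` gives
`‖u‖_{H^{s'}} ≤ C · J_{μ,κ,s}(u)`. [folklore] -/
theorem eFourierSobolevNorm_le_const_mul_J {s' μ κ s C : ℝ} (hC : 0 ≤ C)
    (hW : ∀ ξ : EuclideanSpace ℝ (Fin 3), (1 + ‖ξ‖ ^ 2) ^ (s' / 2) ≤ C * (max ‖ξ‖ μ / κ) ^ s)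
    (u : L2C) : eFourierSobolevNorm s' u ≤ ENNReal.ofReal C * J μ κ s u := by
  rw [eFourierSobolevNorm_eq_half, J, ← lintegral_half_const_mul _ ENNReal.ofReal_ne_top]
  refine lintegral_half_mono_ae (Filter.Eventually.of_forall fun ξ => ?_)
  rw [← mul_assoc, weight, ← ENNReal.ofReal_mul hC]
  exact mul_le_mul' (ENNReal.ofReal_le_ofReal (hW ξ)) le_rfl

/-- The elementary weight comparison behind `H¹⁰` control: for `s ≥ 10`, `0 < μ ≤ κ`, `1 ≤ κ`,
`(1+r²)^5 ≤ 32 κ^{10} (κ/μ)^s · (max(r,μ)/κ)^s` for all `r ≥ 0`. [folklore] -/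
theorem sobolevWeight_le {s μ κ : ℝ} (hs : 10 ≤ s) (hμ : 0 < μ) (hμκ : μ ≤ κ) (hκ : 1 ≤ κ) {r : ℝ}
    (hr : 0 ≤ r) :
    (1 + r ^ 2) ^ ((10 : ℝ) / 2) ≤ 32 * κ ^ 10 * (κ / μ) ^ s * (max r μ / κ) ^ s := by
  set m := max r μ with hm
  have hκ0 : 0 < κ := by linarith
  have hmμ : μ ≤ m := le_max_right _ _
  have hm0 : 0 < m := lt_of_lt_of_le hμ hmμ
  have hrm : r ≤ m := le_max_left _ _
  have hs0 : 0 ≤ s := by linarith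
  have h5 : (1 + r ^ 2) ^ ((10 : ℝ) / 2) = (1 + r ^ 2) ^ 5 := by
    rw [show (10 : ℝ) / 2 = ((5 : ℕ) : ℝ) by norm_num, Real.rpow_natCast]
  rw [h5]
  have hkμ : 1 ≤ (κ / μ) ^ s := Real.one_le_rpow ((one_le_div hμ).2 hμκ) hs0
  rcases le_or_gt κ m with hκm | hmκ
  · have h1 : 1 ≤ m / κ := (one_le_div hκ0).2 hκm
    have h2 : (m / κ) ^ (10 : ℝ) ≤ (m / κ) ^ s := Real.rpow_le_rpow_of_exponent_le h1 hs
    have h3 : (m / κ) ^ (10 : ℝ) = m ^ 10 / κ ^ 10 := by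
      rw [show (10 : ℝ) = ((10 : ℕ) : ℝ) by norm_num, Real.rpow_natCast, div_pow]
    have hm1 : 1 ≤ m := hκ.trans hκm
    calc (1 + r ^ 2) ^ 5 ≤ (1 + m ^ 2) ^ 5 := by gcongr
      _ ≤ (2 * m ^ 2) ^ 5 := by gcongr; nlinarith
      _ = 32 * κ ^ 10 * 1 * (m ^ 10 / κ ^ 10) := by field_simp; ring
      _ ≤ 32 * κ ^ 10 * (κ / μ) ^ s * (m / κ) ^ s := by rw [← h3]; gcongr
  · have h1 : (μ / κ) ^ s ≤ (m / κ) ^ s :=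
      Real.rpow_le_rpow (div_nonneg hμ.le hκ0.le) (div_le_div_of_nonneg_right hmμ hκ0.le) hs0
    have h2 : (κ / μ) ^ s * (μ / κ) ^ s = 1 := by
      rw [← Real.mul_rpow (by positivity) (by positivity), div_mul_div_comm, mul_comm κ μ,
        div_self (by positivity), Real.one_rpow]
    calc (1 + r ^ 2) ^ 5 ≤ (1 + κ ^ 2) ^ 5 := by gcongr; exact hrm.trans hmκ.le
      _ ≤ (2 * κ ^ 2) ^ 5 := by gcongr; nlinarith
      _ = 32 * κ ^ 10 * ((κ / μ) ^ s * (μ / κ) ^ s) := by rw [h2]; ring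
      _ ≤ 32 * κ ^ 10 * ((κ / μ) ^ s * (m / κ) ^ s) := by gcongr
      _ = _ := by ring

/-! ### §2. `H¹⁰` control of the shadowing tube -/

variable {𝒟 : CascadeWaveletData 1 1} {S : CascadeSpecs} {P : Params S}

/-- On the region of `ψ_{n+1}` the generation-`n` weight is `≥ 1`. [folklore] -/
theorem weight_ge_region_succ (P : Params S) (n : ℕ) {ξ : EuclideanSpace ℝ (Fin 3)}
    (h : ξ ∈ freqRegion 𝒟 0 ((n + 1 : ℕ) : ℤ)) : (1 : ℝ) ≤ (max ‖ξ‖ P.μ / S.lam n) ^ P.s := by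
  have h1 := (norm_of_mem_region 𝒟 (n + 1) h).1
  refine Real.one_le_rpow ?_ P.s_nonneg
  rw [P.lam_eq, le_div_iff₀ (pow_pos two_pos n), one_mul]
  refine le_trans ?_ (h1.le.trans (le_max_left _ _))
  exact pow_le_pow_right₀ one_le_two (Nat.le_succ n)

/-- `‖z‖_{H¹⁰} ≤ 32 λ_n^{10} (λ_n/μ)^s · J_n(z)` for `s ≥ 10`, `μ > 0`. [folklore] -/
theorem eFourierSobolevNorm_ten_le_J (hs : 10 ≤ P.s) (hμ : 0 < P.μ) (n : ℕ) (z : L2C) :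
    eFourierSobolevNorm 10 z ≤
      ENNReal.ofReal (32 * S.lam n ^ 10 * (S.lam n / P.μ) ^ P.s) * J P.μ (S.lam n) P.s z := by
  have hκ : 1 ≤ S.lam n := by rw [P.lam_eq]; exact one_le_pow₀ one_le_two
  have hC : (0 : ℝ) ≤ 32 * S.lam n ^ 10 * (S.lam n / P.μ) ^ P.s := by
    have := S.lam_pos n; positivity
  exact eFourierSobolevNorm_le_const_mul_J hC
    (fun ξ => sobolevWeight_le hs hμ (μ_le_lam n) hκ (norm_nonneg ξ)) z

/-- **`H¹⁰` bound from a readout bound and running junk** (the analytic content of `H10Control`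
for the block design; `s ≥ 10`, `μ > 0`): every state whose generation-`n` readout has norm `≤ R'`
and whose junk is below the running threshold has `H¹⁰` norm `≤ M(n, R')`. Mechanism: a state with
running junk has a design state `recon n q` within weighted distance `2 jrun √E_n`; the weight
dominates `(1+|ξ|²)^5` up to `32 λ_n^{10} (λ_n/μ)^s`; and `|q|` is bounded by the readout plus the
junk. [folklore] -/
theorem h10Bound_of_read_le (hs : 10 ≤ P.s) (hμ : 0 < P.μ) (n : ℕ) {R' : ℝ} (hR'0 : 0 ≤ R') :
    ∃ M : ℝ, ∀ v : L2C, ‖read 𝒟 S n v‖ ≤ R' →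
      junk 𝒟 P n v ≤ ENNReal.ofReal (P.jrun * Real.sqrt (S.Emin n)) →
        eFourierSobolevNorm 10 v ≤ ENNReal.ofReal M := by
  have hE := sqrt_Emin_pos S n
  have hE' := sqrt_Emin_pos S (n + 1)
  have hjr := P.jrun_pos
  -- the constants
  have hNtop : ∀ k : ℕ, eFourierSobolevNorm 10 (mode 𝒟 k) ≠ ⊤ := fun k =>
    (𝒟.eFourierSobolevNorm_cascadeWavelet_lt_top two_pos' 10 (by norm_num) 0 _).ne
  set N₁ : ℝ := (eFourierSobolevNorm 10 (mode 𝒟 n)).toReal with hN₁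
  set N₂ : ℝ := (eFourierSobolevNorm 10 (mode 𝒟 (n + 1))).toReal with hN₂
  set C : ℝ := 32 * S.lam n ^ 10 * (S.lam n / P.μ) ^ P.s with hC
  have hC0 : 0 ≤ C := by have := S.lam_pos n; positivity
  set A₁ : ℝ := R' * Real.sqrt (S.Emin n) + 2 * P.jrun * Real.sqrt (S.Emin n) with hA₁
  set A₂ : ℝ := R' * Real.sqrt (S.Emin (n + 1)) + 2 * P.jrun * Real.sqrt (S.Emin n) with hA₂
  have hA₁0 : 0 ≤ A₁ := by positivity
  have hA₂0 : 0 ≤ A₂ := by positivity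
  refine ⟨A₁ * N₁ + A₂ * N₂ + C * (2 * P.jrun * Real.sqrt (S.Emin n)), fun v hr hj => ?_⟩
  -- (a) a near-minimising design state
  have hlt : junk 𝒟 P n v < ENNReal.ofReal (2 * P.jrun * Real.sqrt (S.Emin n)) :=
    lt_of_le_of_lt hj ((ENNReal.ofReal_lt_ofReal_iff (by positivity)).2 (by nlinarith))
  obtain ⟨q, hq⟩ := iInf_lt_iff.1 hlt
  set z : L2C := v - recon 𝒟 S n q with hz
  -- (b) the readout bound, coordinatewise
  have hr1 : |(coef 𝒟 n v).re| ≤ R' * Real.sqrt (S.Emin n) := by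
    have h := (norm_fst_le (read 𝒟 S n v)).trans hr
    rw [Real.norm_eq_abs] at h
    change |(coef 𝒟 n v).re / Real.sqrt (S.Emin n)| ≤ _ at h
    rwa [abs_div, abs_of_pos hE, div_le_iff₀ hE] at h
  have hr2 : |(coef 𝒟 (n + 1) v).re| ≤ R' * Real.sqrt (S.Emin (n + 1)) := by
    have h := (norm_snd_le (read 𝒟 S n v)).trans hr
    rw [Real.norm_eq_abs] at h
    change |(coef 𝒟 (n + 1) v).re / Real.sqrt (S.Emin (n + 1))| ≤ _ at h
    rwa [abs_div, abs_of_pos hE', div_le_iff₀ hE'] at h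
  -- (c) the residual's two design coefficients are controlled by its junk
  have hJ1 : ‖coef 𝒟 n z‖ ≤ 2 * P.jrun * Real.sqrt (S.Emin n) := by
    have h := enorm_coef_le_J 𝒟 n (fun ξ hξ => weight_ge_region_self P n hξ) z
    rw [ENNReal.ofReal_one, one_mul] at h
    have h' := h.trans hq.le
    rwa [← ofReal_norm, ENNReal.ofReal_le_ofReal_iff (by positivity)] at h'
  have hJ2 : ‖coef 𝒟 (n + 1) z‖ ≤ 2 * P.jrun * Real.sqrt (S.Emin n) := by
    have h := enorm_coef_le_J 𝒟 (n + 1) (fun ξ hξ => weight_ge_region_succ P n hξ) z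
    rw [ENNReal.ofReal_one, one_mul] at h
    have h' := h.trans hq.le
    rwa [← ofReal_norm, ENNReal.ofReal_le_ofReal_iff (by positivity)] at h'
  -- hence the design amplitudes are bounded
  have hq1 : ‖((q.1 * Real.sqrt (S.Emin n) : ℝ) : ℂ)‖ ≤ A₁ := by
    have hre : q.1 * Real.sqrt (S.Emin n) = (coef 𝒟 n v).re - (coef 𝒟 n z).re := by
      rw [hz, coef_sub, coef_recon_self, Complex.sub_re, Complex.ofReal_re]; ring
    rw [Complex.norm_real, Real.norm_eq_abs, hre, hA₁]
    have := abs_le.1 hr1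
    have := abs_le.1 ((Complex.abs_re_le_norm (coef 𝒟 n z)).trans hJ1)
    exact abs_le.2 ⟨by linarith, by linarith⟩
  have hq2 : ‖((q.2 * Real.sqrt (S.Emin (n + 1)) : ℝ) : ℂ)‖ ≤ A₂ := by
    have hre : q.2 * Real.sqrt (S.Emin (n + 1)) = (coef 𝒟 (n + 1) v).re - (coef 𝒟 (n + 1) z).re := by
      rw [hz, coef_sub, coef_recon_succ, Complex.sub_re, Complex.ofReal_re]; ring
    rw [Complex.norm_real, Real.norm_eq_abs, hre, hA₂]
    have := abs_le.1 hr2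
    have := abs_le.1 ((Complex.abs_re_le_norm (coef 𝒟 (n + 1) z)).trans hJ2)
    exact abs_le.2 ⟨by linarith, by linarith⟩
  -- (d) the triangle inequality in `H¹⁰`
  have hv : v = recon 𝒟 S n q + z := by rw [hz, add_sub_cancel]
  have hzJ : eFourierSobolevNorm 10 z ≤ ENNReal.ofReal C * ENNReal.ofReal (2 * P.jrun * Real.sqrt (S.Emin n)) :=
    (eFourierSobolevNorm_ten_le_J hs hμ n z).trans (mul_le_mul' le_rfl hq.le)
  have hrecon : eFourierSobolevNorm 10 (recon 𝒟 S n q) ≤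
      ENNReal.ofReal A₁ * ENNReal.ofReal N₁ + ENNReal.ofReal A₂ * ENNReal.ofReal N₂ := by
    unfold recon
    refine (eFourierSobolevNorm_add_le _ _ _).trans ?_
    refine (add_le_add (eFourierSobolevNorm_smul_le _ _ _) (eFourierSobolevNorm_smul_le _ _ _)).trans ?_
    rw [hN₁, hN₂, ENNReal.ofReal_toReal (hNtop n), ENNReal.ofReal_toReal (hNtop (n + 1)),
      ← ofReal_norm, ← ofReal_norm]
    gcongr
  calc eFourierSobolevNorm 10 v
      = eFourierSobolevNorm 10 (recon 𝒟 S n q + z) := by rw [← hv]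
    _ ≤ eFourierSobolevNorm 10 (recon 𝒟 S n q) + eFourierSobolevNorm 10 z :=
        eFourierSobolevNorm_add_le _ _ _
    _ ≤ ENNReal.ofReal A₁ * ENNReal.ofReal N₁ + ENNReal.ofReal A₂ * ENNReal.ofReal N₂ +
          ENNReal.ofReal C * ENNReal.ofReal (2 * P.jrun * Real.sqrt (S.Emin n)) :=
        add_le_add hrecon hzJ
    _ = ENNReal.ofReal (A₁ * N₁ + A₂ * N₂ + C * (2 * P.jrun * Real.sqrt (S.Emin n))) := by
        rw [← ENNReal.ofReal_mul hA₁0, ← ENNReal.ofReal_mul hA₂0, ← ENNReal.ofReal_mul hC0,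
          ← ENNReal.ofReal_add (mul_nonneg hA₁0 ENNReal.toReal_nonneg)
            (mul_nonneg hA₂0 ENNReal.toReal_nonneg),
          ← ENNReal.ofReal_add (by positivity) (by positivity)]

/-- **`H¹⁰` control of the shadowing tube is a theorem for the Fourier-block design** (`s ≥ 10`,
`μ > 0`, bounded circuit tube). [folklore] -/
theorem Dynamics.h10Control (Dy : Dynamics 𝒟 P) (hs : 10 ≤ P.s) (hμ : 0 < P.μ)
    (hT : ∃ R : ℝ, ∀ p ∈ Ain P, ∀ σ : ℝ, 0 ≤ σ → σ ≤ Dy.τc → ‖Dy.Φ σ p‖ ≤ R) :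
    Dy.toShadowedCircuit.H10Control := by
  obtain ⟨R, hR⟩ := hT
  intro n
  obtain ⟨M, hM⟩ := h10Bound_of_read_le (𝒟 := 𝒟) (P := P) hs hμ n (R' := max (R + Dy.δsh) 0)
    (le_max_right _ _)
  refine ⟨M, fun v _ htube hj => hM v ?_ hj⟩
  obtain ⟨p, hp, σ, hσ0, hσ1, hdist⟩ := htube
  change p ∈ Ain P at hp
  change σ ≤ Dy.τc at hσ1
  change dist (read 𝒟 S n v) (Dy.Φ σ p) ≤ Dy.δsh at hdist
  have h1 := hR p hp σ hσ0 hσ1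
  have h2 : ‖read 𝒟 S n v‖ ≤ ‖Dy.Φ σ p‖ + dist (read 𝒟 S n v) (Dy.Φ σ p) := by
    rw [dist_eq_norm]; exact norm_le_insert' _ _
  exact le_trans (by linarith) (le_max_left _ _)

/-! ### §3. Self-similarity -/

/-- `Dil_{2ⁿ} ψ_k = ψ_{n+k}`. [folklore] -/
theorem dil_mode (𝒟 : CascadeWaveletData 1 1) (n k : ℕ) :
    dil ((2 : ℝ) ^ n) (mode 𝒟 k) = mode 𝒟 (n + k) := by
  simp only [mode, cascadeWavelet, one_add_one_eq_two]
  rw [dil_dil (pow_pos two_pos n) (zpow_pos two_pos _), ← zpow_natCast, ← zpow_add₀ two_ne_zero]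
  norm_cast

/-- **The Fourier-block design is self-similar.** [folklore] -/
theorem Dynamics.isSelfSimilar (Dy : Dynamics 𝒟 P) : Dy.toShadowedCircuit.IsSelfSimilar := by
  intro n p
  change recon 𝒟 S n p =
    ((Real.sqrt (S.Emin n / S.Emin 0) : ℝ) : ℂ) • dil ((2 : ℝ) ^ n) (recon 𝒟 S 0 p)
  have h0 := sqrt_Emin_pos S 0
  have hq : Real.sqrt (S.Emin n / S.Emin 0) = Real.sqrt (S.Emin n) / Real.sqrt (S.Emin 0) :=
    Real.sqrt_div' _ (S.Emin_pos 0).le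
  rw [recon, recon, dil_add, dil_smul, dil_smul, dil_mode, dil_mode, add_zero, smul_add, smul_smul,
    smul_smul, ← Complex.ofReal_mul, ← Complex.ofReal_mul, hq]
  congr 3
  · field_simp
  · rw [show n + 1 = n + 1 from rfl, sqrt_Emin_succ S n, show (0 : ℕ) + 1 = 0 + 1 from rfl,
      sqrt_Emin_succ S 0]
    field_simp

end BlockDesign

end Summit.NavierStokesRegularity.FluidComputer

end
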